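import Summits.NavierStokesRegularity.NavierStokesRegularity.Theses.PalasekTowerBreakdown
import Summits.NavierStokesRegularity.FluidComputer.PalasekTowerHeredityAtOneWitness

/-!
# NavierStokesRegularity — route `PalasekTowerBreakdown`, item `HeredityAtOne`: reduction to the typed witness

Supports `stmt-NavierStokesRegularity-19249` (`HeredityAtOne`, the first rung of the split crux
`EpisodeInduction`; it does NOT close it). Cell `ns-blowup`, seat `ns-blowup-ecbridge-6` (D-0074
GROUP C «BRIDGE SUPPORT»). In the route's OWN vocabulary:

  `TaoForcedUniqueness → HeredityWitness 1 → HeredityAtOne`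

— the route's support item `TaoForcedUniqueness` (stmt-…-19180, W14 = Tao 2013 Cor. 11.4 with force)
and the TYPED numerical-witness hypothesis
`Summit.NavierStokesRegularity.FluidComputer.PalasekTowerClayBridge.HeredityWitness 1` («every pinned
rigid quiet wide design that earned a registered G-stage at level 1 has a LEVEL WITNESS: its own
classical finite-energy flow from the Clay datum under the design force reaches `τ 2` below
`(5/3) Y₂` on the window `[τ 1, τ 2]` and shows at `τ 2`, in the ball, a point of speed `≥ Y₂`, a point
of strain `≥ A₂` and the `N₂`-core loop», FluidComputer/PalasekTowerHeredityWitness.lean p417894) give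
the item; and modulo `TaoForcedUniqueness` the item is EQUIVALENT to the witness (nothing weaker or
stronger substituted). The kernel content is
`…PalasekTowerClayBridge.heredityAtOne_of_heredityWitness_W14` / `heredityAt_iff_heredityWitness`
(FluidComputer/PalasekTowerHeredityAtOneWitness.lean p419314): velocity by forced uniqueness,
pressure gauge by Seeley extension, assembly by the BC3 composition. MODEL tower words are analogues
of `HeredityWitness 1`, never instances; nothing here asserts the witness or the item.

WHAT THIS IS NOT: not NS — a conditional reduction; no stage, flow or tower is constructed.
-/

-- `Summit.<Summit>.<Problem>` is the tree's mandated summit-side namespace (CONVENTIONS §2); for this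
-- single-conjunct summit the two coincide, so the duplicate is deliberate.
set_option linter.dupNamespace false

namespace Summit.NavierStokesRegularity.NavierStokesRegularity.Theorems

open Summit.NavierStokesRegularity.NavierStokesRegularity.Theses
open Summit.NavierStokesRegularity.FluidComputer.PalasekTowerClayBridge

/-- **Item `HeredityAtOne` from the route's uniqueness item and the typed heredity witness at level
`1`**: `TaoForcedUniqueness → HeredityWitness 1 → HeredityAtOne` (route decls by name; the body is
`heredityAtOne_of_heredityWitness_W14`). [cite: Tao2011, Cor. 11.4] -/
theorem palasekTowerBreakdown_heredityAtOne_of_heredityWitness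
    (hU : PalasekTowerBreakdown.TaoForcedUniqueness) (h : HeredityWitness 1) :
    PalasekTowerBreakdown.HeredityAtOne := by
  unfold PalasekTowerBreakdown.HeredityAtOne
  unfold PalasekTowerBreakdown.TaoForcedUniqueness at hU
  exact heredityAtOne_of_heredityWitness_W14 hU h

/-- **Modulo the route's uniqueness item, `HeredityAtOne` IS the heredity witness at level `1`**:
`TaoForcedUniqueness → (HeredityAtOne ↔ HeredityWitness 1)`. [cite: Tao2011, Cor. 11.4] -/
theorem palasekTowerBreakdown_heredityAtOne_iff_heredityWitness
    (hU : PalasekTowerBreakdown.TaoForcedUniqueness) :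
    PalasekTowerBreakdown.HeredityAtOne ↔ HeredityWitness 1 := by
  unfold PalasekTowerBreakdown.HeredityAtOne
  unfold PalasekTowerBreakdown.TaoForcedUniqueness at hU
  rw [heredityAtOne_iff]
  exact heredityAt_iff_heredityWitness
    (Literature.Analysis.FluidPDE.tao2011_forced_unconditionalUniqueness_velocity.schwartzForce hU)

/-- The free direction needs no uniqueness: the item itself yields the witness at level `1`.
[folklore] -/
theorem palasekTowerBreakdown_heredityWitness_one_of_heredityAtOne
    (h : PalasekTowerBreakdown.HeredityAtOne) : HeredityWitness 1 := by
  unfold PalasekTowerBreakdown.HeredityAtOne at h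
  exact HeredityAtOne.heredityWitness h

end Summit.NavierStokesRegularity.NavierStokesRegularity.Theorems
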